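import Literature.RepresentationTheory.TwistedCoinvariantsTypePeriodicity
import Literature.RepresentationTheory.TwistedCoinvariantsCompactEigenvector
import HarnessLib

/-!
# A non-zero smooth representation of a compact commutative group HAS a type: some open-kernel character occurs in
# its twisted coinvariants

Topic `RepresentationTheory`; namespace `Literature.RepresentationTheory.TwistedCoinv` (continuing ★ `TwistedCoinvariants`,
★ `TwistedCoinvariantsTypePeriodicity`, ★ `TwistedCoinvariantsCompactEigenvector`).  KERNEL ONLY: theorems, 0 definitions, 0 named facts,
0 `sorry`.  Cell hodgecm-mathlib, fan B rung B-IV (local theta ∕ types of oscillator representations); `--supports stmt-HodgeConjecture-24832`.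

For a representation `ρ` of a COMPACT topological group `K` whose elements commute on a complex vector space `S`:

* §1 `exists_character_weightSpace_ne_bot_of_mem_fixedPoints` (finite level, algebra + compactness): if `K₀ ≤ K` is an OPEN subgroup and
  `w ≠ 0` is `K₀`-fixed, there is a character `ξ : K →* ℂˣ` TRIVIAL ON `K₀` with a non-zero `(K, ξ)`-eigenvector — the isotypic sums
  `Σ_{q ∈ K/K₀} ψ(q)⁻¹ ρ(q̃) w` over the characters `ψ` of the finite abelian group `K/K₀` add up to `[K:K₀] · w` (character orthogonality,
  Mathlib `AddChar.sum_apply_eq_ite`), so one of them is non-zero, and each lies in the weight space of `k ↦ ψ(k K₀)` (the computation of ★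
  `finite_fixedPoints_of_finite_weightSpace`, verbatim);
* §2 `exists_character_nontrivial_coinv_of_isSmooth` (topology): if `ρ` is SMOOTH (open stabilisers) and `S ≠ 0`, there is a character `ξ` of `K`
  with OPEN kernel, unitary and continuous, whose twisted coinvariants `Coinv ρ ξ` are NON-ZERO (§1 at `K₀ = Stab(w)`, then the eigenvector
  survives: ★ `mk_ne_zero_of_eigenvector`); and the trivial converse `nontrivial_of_nontrivial_coinv` (a quotient of `0` is `0`).

This is the standard «`V = ⊕_ξ V[ξ]` for smooth representations of compact (totally disconnected, abelian) groups» ([BernsteinZelevinsky1976,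
§2.1–2.3]; [MoeglinVignerasWaldspurger1987, Chap. 2 II.2]) in the occurrence form the seesaw arguments of the rank-one theta correspondence use:
«a non-zero `U(J₁)(F_v)`-representation has a `U(J₁)`-type» (`U(J₁)(F_v) = E_v¹` the compact torus at a non-split place; consumer: the two-block
type criterion for `Θ_s(χ)` over ★ `RankOneThetaLiftLineTypes.coinvLineEquiv`).  HC_CM is proved only modulo the printed citations — the 2
remaining named inputs (hLiu418 = stmt-HodgeConjecture-24832, h413 = 24833) — until rung 0 closes; count-neutral.

## References
* [BernsteinZelevinsky1976] I. N. Bernstein, A. V. Zelevinsky, *Representations of the group GL(n, F) where F is a non-archimedean local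
  field*, Russian Math. Surveys 31 (1976), §2.1–2.3.
* [Serre1977] J.-P. Serre, *Linear representations of finite groups*, GTM 42, §2.3 (orthogonality), §2.6 Thm. 8 (isotypic projectors).
* [MoeglinVignerasWaldspurger1987] C. Mœglin, M.-F. Vignéras, J.-L. Waldspurger, LNM 1291 (1987), Chap. 2 II.2.
-/

set_option autoImplicit false

noncomputable section

open scoped BigOperators

namespace Literature.RepresentationTheory.TwistedCoinv

section Compact

variable {K : Type*} [Group K] [TopologicalSpace K] [IsTopologicalGroup K] [CompactSpace K]
  {S : Type*} [AddCommGroup S] [Module ℂ S] (ρ : Representation ℂ K S)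

omit [TopologicalSpace K] [IsTopologicalGroup K] [CompactSpace K] in
/-- If the elements of `K` commute, every subgroup is normal. (Bookkeeping.) [folklore] -/
private theorem normal_of_comm' (hcomm : ∀ a b : K, a * b = b * a) (K₀ : Subgroup K) : K₀.Normal :=
  ⟨fun n hn g => by rwa [hcomm g n, mul_inv_cancel_right]⟩

/-! ## §1. Finite level: a non-zero `K₀`-fixed vector has a non-zero isotypic component for some character trivial on `K₀` -/

/-- **A non-zero `K₀`-fixed vector has a TYPE.**  `K` compact with commuting elements, `ρ` a representation of `K` on a complex vector space
`S`, `K₀ ≤ K` an open subgroup, `w ∈ S^{K₀}` non-zero.  Then there is a character `ξ : K →* ℂˣ` with `K₀ ≤ ker ξ` and a NON-ZERO vector `v`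
with `ρ k v = ξ k • v` for all `k` (namely an isotypic sum `Σ_{q ∈ K/K₀} ψ(q)⁻¹ ρ(q̃) w`: these add up to `[K:K₀] · w ≠ 0` over the characters
`ψ` of `K/K₀`). [cite: Serre1977, §2.6 Thm. 8; §2.3] [cite: BernsteinZelevinsky1976, §2.1] -/
theorem exists_character_eigenvector_of_mem_fixedPoints (hcomm : ∀ a b : K, a * b = b * a)
    (K₀ : Subgroup K) (hK₀ : IsOpen (K₀ : Set K)) {w : S} (hw : w ∈ ρ.fixedPoints K₀) (hw0 : w ≠ 0) :
    ∃ ξ : K →* ℂˣ, K₀ ≤ ξ.ker ∧ ∃ v : S, v ≠ 0 ∧ ∀ k : K, ρ k v = ((ξ k : ℂˣ) : ℂ) • v := by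
  classical
  haveI : K₀.Normal := normal_of_comm' hcomm K₀
  haveI : Finite (K ⧸ K₀) := Subgroup.quotient_finite_of_isOpen K₀ hK₀
  letI : Fintype (K ⧸ K₀) := Fintype.ofFinite _
  letI : CommGroup (K ⧸ K₀) :=
    { (inferInstance : Group (K ⧸ K₀)) with
      mul_comm := fun x y => by
        obtain ⟨a, rfl⟩ := QuotientGroup.mk_surjective x
        obtain ⟨b, rfl⟩ := QuotientGroup.mk_surjective y
        rw [← QuotientGroup.mk_mul, ← QuotientGroup.mk_mul, hcomm] }
  have hc : (Fintype.card (K ⧸ K₀) : ℂ) ≠ 0 := Nat.cast_ne_zero.2 Fintype.card_ne_zero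
  -- the isotypic sums `P_ψ w := Σ_{q ∈ K/K₀} ψ(q)⁻¹ • ρ q̃ w`
  set P : AddChar (Additive (K ⧸ K₀)) ℂ → S := fun ψ => ∑ q : K ⧸ K₀, (ψ (Additive.ofMul q))⁻¹ • ρ q.out w with hP
  -- they add up to `[K:K₀] · w`
  have hsum : (Fintype.card (K ⧸ K₀) : ℂ) • w = ∑ ψ : AddChar (Additive (K ⧸ K₀)) ℂ, P ψ := by
    simp only [hP]
    rw [Finset.sum_comm]
    simp_rw [← Finset.sum_smul, ← AddChar.map_neg_eq_inv]
    have h : ∀ q : K ⧸ K₀, ∑ ψ : AddChar (Additive (K ⧸ K₀)) ℂ, ψ (-Additive.ofMul q) =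
        if q = 1 then (Fintype.card (K ⧸ K₀) : ℂ) else 0 := fun q => by
      rw [AddChar.sum_apply_eq_ite]
      by_cases hq : q = 1
      · subst hq
        simp
      · have hne : ¬(-Additive.ofMul q = 0) := by rwa [neg_eq_zero, ofMul_eq_zero]
        rw [if_neg hne, if_neg hq]
    simp_rw [h, ite_smul, zero_smul, Finset.sum_ite_eq', Finset.mem_univ, if_true]
    have h1 : ((1 : K ⧸ K₀).out : K) ∈ K₀ := by
      rw [← QuotientGroup.eq_one_iff, QuotientGroup.out_eq']
    rw [(Representation.mem_fixedPoints ρ K₀ w).1 hw _ h1]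
  -- each `P_ψ w` is a `(K, ψ ∘ mk)`-eigenvector
  have hmem : ∀ (ψ : AddChar (Additive (K ⧸ K₀)) ℂ) (t : K), ρ t (P ψ) = ψ (Additive.ofMul (t : K ⧸ K₀)) • P ψ := by
    intro ψ t
    simp only [hP, map_sum, map_smul, Finset.smul_sum]
    -- re-index by `q ↦ (t : K/K₀)⁻¹ * q`
    rw [← Equiv.sum_comp (Equiv.mulLeft ((t : K ⧸ K₀)⁻¹))]
    refine Finset.sum_congr rfl fun q _ => ?_
    rw [Equiv.coe_mulLeft, ← Module.End.mul_apply, ← map_mul]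
    -- `t * ((t⁻¹ q).out)` and `q.out` differ by an element of `K₀`
    have hK : (t * ((t : K ⧸ K₀)⁻¹ * q).out : K) * (q.out : K)⁻¹ ∈ K₀ := by
      rw [← QuotientGroup.eq_one_iff, QuotientGroup.mk_mul, QuotientGroup.mk_mul, QuotientGroup.out_eq',
        QuotientGroup.mk_inv, QuotientGroup.out_eq', mul_inv_cancel_left, mul_inv_cancel]
    have hfix := (Representation.mem_fixedPoints ρ K₀ w).1 hw _ hK
    have hρ : ρ (t * ((t : K ⧸ K₀)⁻¹ * q).out) w = ρ q.out w := by
      set X : K := t * ((t : K ⧸ K₀)⁻¹ * q).out with hX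
      calc ρ X w = ρ (X * (q.out : K)⁻¹ * q.out) w := by rw [inv_mul_cancel_right]
        _ = ρ (q.out * (X * (q.out : K)⁻¹)) w := by rw [hcomm]
        _ = ρ q.out (ρ (X * (q.out : K)⁻¹) w) := by rw [map_mul, Module.End.mul_apply]
        _ = ρ q.out w := by rw [hfix]
    rw [hρ, smul_smul, ofMul_mul, ofMul_inv, AddChar.map_add_eq_mul, AddChar.map_neg_eq_inv, mul_inv, inv_inv]
  -- one of the isotypic sums is non-zero
  have hex : ∃ ψ : AddChar (Additive (K ⧸ K₀)) ℂ, P ψ ≠ 0 := by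
    by_contra h
    simp only [not_exists, not_not] at h
    have h0 : (Fintype.card (K ⧸ K₀) : ℂ) • w = 0 := by
      rw [hsum]
      exact Finset.sum_eq_zero fun ψ _ => h ψ
    rcases smul_eq_zero.1 h0 with h1 | h1
    · exact hc h1
    · exact hw0 h1
  obtain ⟨ψ, hψ⟩ := hex
  -- the unit-valued character `ξ_ψ : K →* ℂˣ`
  let ξ : K →* ℂˣ :=
    { toFun := fun k => Units.mk0 (ψ (Additive.ofMul (k : K ⧸ K₀))) ((ψ.val_isUnit _).ne_zero)
      map_one' := by ext; simp
      map_mul' := fun a b => by ext; simp [AddChar.map_add_eq_mul] }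
  have hξ : K₀ ≤ ξ.ker := fun k hk => by
    rw [MonoidHom.mem_ker]
    ext
    simp [ξ, (QuotientGroup.eq_one_iff k).2 hk]
  refine ⟨ξ, hξ, P ψ, hψ, fun k => ?_⟩
  rw [hmem ψ k]
  rfl

/-! ## §2. Smooth representations: a non-zero smooth representation of a compact commutative group has an open-kernel type -/

/-- **A non-zero SMOOTH representation of a compact group with commuting elements has a TYPE**: there is a character `ξ : K →* ℂˣ` with
OPEN kernel — hence continuous and unitary — whose twisted coinvariants `Coinv ρ ξ` are NON-ZERO.  (§1 at the open stabiliser `K₀ = Stab(w)` of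
a non-zero vector `w`; the resulting eigenvector survives in the coinvariants by ★ `mk_ne_zero_of_eigenvector`.)
[cite: BernsteinZelevinsky1976, §2.3] [cite: MoeglinVignerasWaldspurger1987, Chap. 2 II.2] -/
theorem exists_character_nontrivial_coinv_of_isSmooth (hcomm : ∀ a b : K, a * b = b * a) (hρ : ρ.IsSmooth)
    [Nontrivial S] :
    ∃ ξ : K →* ℂˣ, IsOpen (ξ.ker : Set K) ∧ (∀ u, ‖((ξ u : ℂˣ) : ℂ)‖ = 1) ∧ (Continuous fun u => ((ξ u : ℂˣ) : ℂ)) ∧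
      Nontrivial (Coinv ρ ξ) := by
  obtain ⟨w, hw0⟩ := exists_ne (0 : S)
  set K₀ : Subgroup K := ρ.stabilizerSubgroup w with hK₀
  have hK₀o : IsOpen (K₀ : Set K) := hρ w
  have hw : w ∈ ρ.fixedPoints K₀ := (Representation.mem_fixedPoints ρ K₀ w).2 fun k hk => (ρ.mem_stabilizerSubgroup w k).1 hk
  obtain ⟨ξ, hξ, v, hv0, hv⟩ := exists_character_eigenvector_of_mem_fixedPoints ρ hcomm K₀ hK₀o hw hw0
  haveI : K₀.Normal := normal_of_comm' hcomm K₀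
  haveI : Finite (K ⧸ K₀) := Subgroup.quotient_finite_of_isOpen K₀ hK₀o
  have hξo : IsOpen (ξ.ker : Set K) := Subgroup.isOpen_mono hξ hK₀o
  exact ⟨ξ, hξo, norm_coe_eq_one_of_le_ker ξ K₀ hξ, continuous_coe_of_le_ker ξ K₀ hK₀o hξ,
    nontrivial_of_ne _ _ (mk_ne_zero_of_eigenvector ρ ξ hρ hξo hv0 hv)⟩

omit [TopologicalSpace K] [IsTopologicalGroup K] [CompactSpace K] in
/-- The trivial converse: non-zero twisted coinvariants `Coinv ρ ξ = S ⧸ span {ρ h w - ξ h • w}` come from a non-zero space `S`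
(bookkeeping for the occurrence criterion above). [cite: BernsteinZelevinsky1976, §2.3] -/
theorem nontrivial_of_nontrivial_coinv (ξ : K →* ℂˣ) [h : Nontrivial (Coinv ρ ξ)] : Nontrivial S := by
  by_contra hS
  haveI : Subsingleton S := not_nontrivial_iff_subsingleton.1 hS
  exact not_subsingleton (Coinv ρ ξ) inferInstance

end Compact

end Literature.RepresentationTheory.TwistedCoinv

end
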